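import Summits.AtomisticToContinuum.Crystallization.Theorems.PricedLinkCensusStackingHingeRelaxedStarRigidity

/-!
# Route `PricedLinkCensus`, crux `StackingHinge` (stmt-AtomisticToContinuum-14993), line `Sketch`:
# stub `stub_similarStarNormalisation` (V3), support file III — the two reference stars

Finite geometry of the two reference stars of line `Sketch` on the parameter box
`189/200 ≤ a ≤ 199/200`, `77/100 ≤ h ≤ 163/200`: the relaxed-hcp star `refStar a h` (six in-layer
struts of length `a`, six polar struts of squared length `ρ² = a²/3 + h²`) and the regular
cuboctahedron `a • fccKissingPattern` (twelve struts of length `a`).  For `F` either of the two: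

* norms of points of `F` lie in `[9/10, 5/4]`, are `a` or have square `ρ²`, and some point has
  norm `a` (`norm_cases`, `norm_bounds`, `exists_norm_eq`);
* two distinct points of `F` are at distance `a`, or at squared distance `ρ²`, or MORE THAN `5/4`
  apart (`dist_cases`: the integer metric of the labels, `star_pairs`, resp. the squared lengths
  `2, 4, 6, 8` of differences of minimal vectors of `D₃`);
* every point `v` of `F` has a companion `u ∈ F` at distance `a` of the same strut type
  (`exists_adj_inLayer`, `exists_adj_polar`, `exists_adj_fcc`), and two distinct polar struts are
  at distance `a` or at squared distance `≥ 4 h²` (`polar_dist_cases`).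

All `[folklore]` (finite checks by `decide` on the label set `hcpStarIdx` and on `fccInt`).
-/

noncomputable section

namespace Summit.AtomisticToContinuum.Crystallization.Theorems.PricedHcpWindowsSimilarStarNormalisation

open Literature.MathematicalPhysics.StatisticalMechanics Literature.Geometry.DiscreteGeometry
open Summit.AtomisticToContinuum.Crystallization.Theorems.PalmUnimodularRigidity.LayeredLawsSelectHcp
open Summit.AtomisticToContinuum.Crystallization.Theorems.PricedHcpWindowsIdealStarRigidity
open Summit.AtomisticToContinuum.Crystallization.Theorems.PricedHcpWindowsRelaxedStarRigidity

/-! ## Integer facts -/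

/-- **More finite combinatorics of the twelve star labels** (by `decide`): the in-layer label
`(0,1,0)`; every polar label has a polar label of its own triangle at metric `(12, 0)`; two distinct
polar labels are at metric `(12, 0)` (same triangle) or have `q₂ ≥ 4` (opposite triangles).
[folklore] -/
theorem starIdx_facts₂ :
    (((0, 1, 0) : ℤ × ℤ × ℤ) ∈ hcpStarIdx ∧ siteQ ((0, 1, 0) : ℤ × ℤ × ℤ) 0 = (12, 0)) ∧
    (∀ v ∈ hcpStarIdx, v.1 ≠ 0 →
      ∃ u ∈ hcpStarIdx, u.1 ≠ 0 ∧ siteQ u 0 = (4, 1) ∧ siteQ u v = (12, 0)) ∧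
    (∀ u ∈ hcpStarIdx, ∀ w ∈ hcpStarIdx, u.1 ≠ 0 → w.1 ≠ 0 → u ≠ w →
      siteQ u w = (12, 0) ∨ 4 ≤ (siteQ u w).2) := by
  decide

/-- The polar label `(1,0,0)` (by `decide`). [folklore] -/
theorem starIdx_facts₃ :
    ((1, 0, 0) : ℤ × ℤ × ℤ) ∈ hcpStarIdx ∧ siteQ ((1, 0, 0) : ℤ × ℤ × ℤ) 0 = (4, 1) := by
  decide

/-- **Minimal vectors of `D₃`** (by `decide`): every one has another at squared distance `2`, and
two distinct ones are at squared distance `2` or `≥ 4`. [folklore] -/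
theorem fccInt_facts :
    (∀ v ∈ fccInt, ∃ u ∈ fccInt, sqNormInt (u - v) = 2) ∧
    (∀ v ∈ fccInt, ∀ w ∈ fccInt, v ≠ w → sqNormInt (v - w) = 2 ∨ 4 ≤ sqNormInt (v - w)) := by
  decide

/-! ## The cuboctahedron -/

/-- Distance of two points of the FCC pattern in terms of the integer model. [folklore] -/
theorem dist_fcc_eq (v w : Fin 3 → ℤ) :
    dist ((Real.sqrt (2 : ℕ))⁻¹ • intVec v : EuclideanSpace ℝ (Fin 3))
      ((Real.sqrt (2 : ℕ))⁻¹ • intVec w) = (Real.sqrt 2)⁻¹ * Real.sqrt (sqNormInt (v - w) : ℝ) := by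
  have hpos : (0 : ℝ) < Real.sqrt 2 := by positivity
  rw [dist_eq_norm, ← smul_sub, intVec_sub, norm_smul, norm_inv, Nat.cast_ofNat,
    Real.norm_of_nonneg hpos.le, norm_intVec]

/-- **Distances in the FCC pattern**: two distinct points are at distance `1` or `≥ √2`.
[folklore] -/
theorem fcc_dist_cases {x y : EuclideanSpace ℝ (Fin 3)}
    (hx : x ∈ (fccKissingPattern : Set (EuclideanSpace ℝ (Fin 3))))
    (hy : y ∈ (fccKissingPattern : Set (EuclideanSpace ℝ (Fin 3)))) (hxy : x ≠ y) :
    dist x y = 1 ∨ Real.sqrt 2 ≤ dist x y := by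
  rw [Finset.mem_coe, fccKissingPattern, scaledPattern, Finset.mem_image] at hx hy
  obtain ⟨v, hv, rfl⟩ := hx
  obtain ⟨w, hw, rfl⟩ := hy
  have hvw : v ≠ w := fun h => hxy (by rw [h])
  have hpos : (0 : ℝ) < Real.sqrt 2 := by positivity
  rw [dist_fcc_eq]
  rcases fccInt_facts.2 v hv w hw hvw with h2 | h4
  · left
    rw [h2]; push_cast
    rw [inv_mul_cancel₀ hpos.ne']
  · right
    have h4' : (4 : ℝ) ≤ (sqNormInt (v - w) : ℝ) := by exact_mod_cast h4
    have hs : (2 : ℝ) ≤ Real.sqrt (sqNormInt (v - w) : ℝ) := by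
      rw [show (2 : ℝ) = Real.sqrt 4 by rw [show (4 : ℝ) = 2 ^ 2 by norm_num, Real.sqrt_sq (by norm_num)]]
      exact Real.sqrt_le_sqrt h4'
    rw [le_inv_mul_iff₀ hpos]
    have h22 : Real.sqrt 2 * Real.sqrt 2 = 2 := Real.mul_self_sqrt (by norm_num)
    nlinarith

/-- **Every point of the FCC pattern has a neighbour at distance `1`** (four, in fact). [folklore] -/
theorem fcc_exists_adj {x : EuclideanSpace ℝ (Fin 3)}
    (hx : x ∈ (fccKissingPattern : Set (EuclideanSpace ℝ (Fin 3)))) :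
    ∃ y ∈ (fccKissingPattern : Set (EuclideanSpace ℝ (Fin 3))), dist y x = 1 := by
  rw [Finset.mem_coe, fccKissingPattern, scaledPattern, Finset.mem_image] at hx
  obtain ⟨v, hv, rfl⟩ := hx
  obtain ⟨u, hu, h2⟩ := fccInt_facts.1 v hv
  have hpos : (0 : ℝ) < Real.sqrt 2 := by positivity
  refine ⟨(Real.sqrt (2 : ℕ))⁻¹ • intVec u, ?_, ?_⟩
  · rw [Finset.mem_coe, fccKissingPattern, scaledPattern, Finset.mem_image]
    exact ⟨u, hu, rfl⟩
  · rw [dist_fcc_eq, h2]; push_cast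
    rw [inv_mul_cancel₀ hpos.ne']

/-- Membership in the scaled FCC pattern, unfolded. [folklore] -/
theorem mem_image_fcc_iff {a : ℝ} {y : EuclideanSpace ℝ (Fin 3)} :
    y ∈ (fun p : EuclideanSpace ℝ (Fin 3) => a • p) ''
      (fccKissingPattern : Set (EuclideanSpace ℝ (Fin 3))) ↔
      ∃ x ∈ (fccKissingPattern : Set (EuclideanSpace ℝ (Fin 3))), a • x = y := Iff.rfl

/-! ## The two reference stars on the box -/

section Box

variable {a h : ℝ} (ha₁ : 189 / 200 ≤ a) (ha₂ : a ≤ 199 / 200) (hh₁ : 77 / 100 ≤ h)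
  (hh₂ : h ≤ 163 / 200) {F : Set (EuclideanSpace ℝ (Fin 3))}
  (hF : F = (refStar a h : Set (EuclideanSpace ℝ (Fin 3))) ∨
    F = (fun p : EuclideanSpace ℝ (Fin 3) => a • p) ''
      (fccKissingPattern : Set (EuclideanSpace ℝ (Fin 3))))
include ha₁ ha₂ hh₁ hh₂ hF

omit ha₂ hh₁ hh₂ in
/-- **Norms**: a point of a reference star has norm `a` or squared norm `a²/3 + h²` (the latter
only for the hcp star). [folklore] -/
theorem norm_cases {v : EuclideanSpace ℝ (Fin 3)} (hv : v ∈ F) :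
    ‖v‖ = a ∨ (‖v‖ ^ 2 = a ^ 2 / 3 + h ^ 2 ∧
      F = (refStar a h : Set (EuclideanSpace ℝ (Fin 3)))) := by
  have ha : 0 ≤ a := by linarith
  rcases hF with rfl | rfl
  · rcases mem_refStar_cases ha hv with ⟨h1, -⟩ | ⟨h1, -⟩
    · exact Or.inl h1
    · exact Or.inr ⟨h1, rfl⟩
  · obtain ⟨x, hx, rfl⟩ := hv
    left
    rw [norm_smul, Real.norm_of_nonneg ha, norm_eq_one_of_mem_fccKissingPattern hx, mul_one]

/-- **Norm bounds**: points of a reference star have norm in `[9/10, 5/4]`. [folklore] -/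
theorem norm_bounds {v : EuclideanSpace ℝ (Fin 3)} (hv : v ∈ F) : 9 / 10 ≤ ‖v‖ ∧ ‖v‖ ≤ 5 / 4 := by
  have hn : 0 ≤ ‖v‖ := norm_nonneg v
  rcases norm_cases ha₁ hF hv with h1 | ⟨h1, -⟩
  · rw [h1]; constructor <;> linarith
  · constructor <;> nlinarith

/-- Points of a reference star are non-zero. [folklore] -/
theorem ne_zero_of_mem {v : EuclideanSpace ℝ (Fin 3)} (hv : v ∈ F) : v ≠ 0 := by
  have := (norm_bounds ha₁ ha₂ hh₁ hh₂ hF hv).1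
  intro h0
  rw [h0, norm_zero] at this
  linarith

omit ha₂ hh₁ hh₂ in
/-- **Some strut has length `a`** (an in-layer strut of the hcp star; any strut of the fcc star).
[folklore] -/
theorem exists_norm_eq : ∃ v ∈ F, ‖v‖ = a := by
  have ha : 0 ≤ a := by linarith
  rcases hF with rfl | rfl
  · exact ⟨hcpSite a h (0, 1, 0), hcpSite_mem_refStar starIdx_facts₂.1.1,
      norm_hcpSite_of_siteQ_eq ha starIdx_facts₂.1.2⟩
  · have hne : (fccKissingPattern : Finset (EuclideanSpace ℝ (Fin 3))).Nonempty := by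
      rw [← Finset.card_pos, card_fccKissingPattern]; norm_num
    obtain ⟨x, hx⟩ := hne
    exact ⟨a • x, ⟨x, hx, rfl⟩, by
      rw [norm_smul, Real.norm_of_nonneg ha, norm_eq_one_of_mem_fccKissingPattern hx, mul_one]⟩

omit ha₁ ha₂ hh₁ hh₂ hF in
/-- **Some strut of the hcp star is polar** (squared length `a²/3 + h²`). [folklore] -/
theorem exists_norm_sq_eq_refStar (a h : ℝ) :
    ∃ v ∈ (refStar a h : Set (EuclideanSpace ℝ (Fin 3))), ‖v‖ ^ 2 = a ^ 2 / 3 + h ^ 2 :=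
  ⟨hcpSite a h (1, 0, 0), hcpSite_mem_refStar starIdx_facts₃.1,
    norm_sq_hcpSite_of_siteQ_eq starIdx_facts₃.2⟩

omit ha₁ ha₂ hh₁ hh₂ in
/-- The reference stars are finite. [folklore] -/
theorem finite_ref : F.Finite := by
  rcases hF with rfl | rfl
  · exact Finset.finite_toSet _
  · exact (Finset.finite_toSet _).image _

omit ha₂ hh₂ in
/-- **Distances within a reference star**: two distinct points are at distance `a`, or at squared
distance `a²/3 + h²` (hcp star only), or more than `5/4` apart. [folklore] -/
theorem dist_cases {v w : EuclideanSpace ℝ (Fin 3)} (hv : v ∈ F) (hw : w ∈ F) (hvw : v ≠ w) :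
    dist v w = a ∨ (dist v w ^ 2 = a ^ 2 / 3 + h ^ 2 ∧
      F = (refStar a h : Set (EuclideanSpace ℝ (Fin 3)))) ∨ 5 / 4 < dist v w := by
  have ha : 0 ≤ a := by linarith
  have hd : 0 ≤ dist v w := dist_nonneg
  rcases hF with rfl | rfl
  · obtain ⟨lv, hlv, rfl⟩ := mem_coe_refStar_iff.1 hv
    obtain ⟨lw, hlw, rfl⟩ := mem_coe_refStar_iff.1 hw
    obtain ⟨m, rfl⟩ := exists_starLab_eq hlv
    obtain ⟨n, rfl⟩ := exists_starLab_eq hlw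
    have hmn : m ≠ n := by rintro rfl; exact hvw rfl
    have hsq := hcpSite_dist_sq a h (starLab m) (starLab n)
    obtain ⟨hq1, hq2⟩ := siteQ_nonneg (starLab m) (starLab n)
    have hq1' : (0 : ℝ) ≤ (siteQ (starLab m) (starLab n)).1 := by exact_mod_cast hq1
    have hq2' : (0 : ℝ) ≤ (siteQ (starLab m) (starLab n)).2 := by exact_mod_cast hq2
    rcases star_pairs.1 m n hmn with ⟨-, hq | hq⟩ | ⟨-, hfar⟩
    · left
      exact dist_hcpSite_of_siteQ_eq ha (v := starLab n) (w := starLab m) hq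
    · right; left
      exact ⟨dist_sq_hcpSite_of_siteQ_eq (v := starLab n) (w := starLab m) hq, rfl⟩
    · right; right
      have h2516 : (5 / 4 : ℝ) ^ 2 < dist (hcpSite a h (starLab m)) (hcpSite a h (starLab n)) ^ 2 := by
        rw [hsq]
        rcases hfar with h4 | ⟨h1, h16⟩ | h24
        · have h4' : (4 : ℝ) ≤ (siteQ (starLab m) (starLab n)).2 := by exact_mod_cast h4
          nlinarith
        · have h1' : (1 : ℝ) ≤ (siteQ (starLab m) (starLab n)).2 := by exact_mod_cast h1
          have h16' : (16 : ℝ) ≤ (siteQ (starLab m) (starLab n)).1 := by exact_mod_cast h16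
          nlinarith
        · have h24' : (24 : ℝ) ≤ (siteQ (starLab m) (starLab n)).1 := by exact_mod_cast h24
          nlinarith
      exact lt_of_pow_lt_pow_left₀ 2 hd h2516
  · obtain ⟨x, hx, rfl⟩ := hv
    obtain ⟨y, hy, rfl⟩ := hw
    have hxy : x ≠ y := fun h => hvw (by rw [h])
    have hd' : dist (a • x) (a • y) = a * dist x y := by
      rw [dist_smul₀, Real.norm_of_nonneg ha]
    rw [hd']
    rcases fcc_dist_cases hx hy hxy with h1 | h2
    · left; rw [h1, mul_one]
    · right; right
      have hs : (7 / 5 : ℝ) < Real.sqrt 2 := by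
        rw [Real.lt_sqrt (by norm_num)]; norm_num
      nlinarith

omit ha₂ hh₁ hh₂ in
/-- **In-layer struts have in-layer companions**: a point of norm `a` of a reference star, off the
ideal ratio, has a point of the star of norm `a` at distance `a`. [folklore] -/
theorem exists_adj_inLayer (hρ : a ^ 2 / 3 + h ^ 2 ≠ a ^ 2) {v : EuclideanSpace ℝ (Fin 3)}
    (hv : v ∈ F) (hn : ‖v‖ = a) : ∃ u ∈ F, ‖u‖ = a ∧ dist u v = a := by
  have ha : 0 ≤ a := by linarith
  rcases hF with rfl | rfl
  · obtain ⟨lv, hlv, rfl⟩ := mem_coe_refStar_iff.1 hv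
    have hk : lv.1 = 0 := by
      rcases starIdx_facts.1 lv hlv with ⟨hk, -⟩ | ⟨-, hq⟩
      · exact hk
      · exfalso
        have := norm_sq_hcpSite_of_siteQ_eq (a := a) (h := h) hq
        rw [hn] at this
        exact hρ this.symm
    obtain ⟨lu, hlu, -, hq0, hqv, -⟩ := starIdx_facts.2.2.2.1 lv hlv hk
    exact ⟨hcpSite a h lu, hcpSite_mem_refStar hlu, norm_hcpSite_of_siteQ_eq ha hq0,
      dist_hcpSite_of_siteQ_eq ha hqv⟩
  · obtain ⟨x, hx, rfl⟩ := hv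
    obtain ⟨y, hy, hyx⟩ := fcc_exists_adj hx
    refine ⟨a • y, ⟨y, hy, rfl⟩, ?_, ?_⟩
    · rw [norm_smul, Real.norm_of_nonneg ha, norm_eq_one_of_mem_fccKissingPattern hy, mul_one]
    · rw [dist_smul₀, Real.norm_of_nonneg ha, hyx, mul_one]

omit ha₂ hh₁ hh₂ in
/-- **Polar struts have polar companions**: a point of squared norm `a²/3 + h² ≠ a²` of a
reference star (necessarily the hcp star) has a point of the star of the same squared norm at
distance `a` (its triangle). [folklore] -/
theorem exists_adj_polar (hρ : a ^ 2 / 3 + h ^ 2 ≠ a ^ 2) {v : EuclideanSpace ℝ (Fin 3)}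
    (hv : v ∈ F) (hn : ‖v‖ ^ 2 = a ^ 2 / 3 + h ^ 2) :
    ∃ u ∈ F, ‖u‖ ^ 2 = a ^ 2 / 3 + h ^ 2 ∧ dist u v = a := by
  have ha : 0 ≤ a := by linarith
  rcases norm_cases ha₁ hF hv with h1 | ⟨-, hFh⟩
  · exfalso; rw [h1] at hn; exact hρ hn.symm
  subst hFh
  obtain ⟨lv, hlv, rfl⟩ := mem_coe_refStar_iff.1 hv
  have hk : lv.1 ≠ 0 := by
    rcases starIdx_facts.1 lv hlv with ⟨-, hq⟩ | ⟨hk, -⟩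
    · exfalso
      have := norm_hcpSite_of_siteQ_eq (a := a) (h := h) ha hq
      rw [this] at hn
      exact hρ hn.symm
    · rcases hk with hk | hk <;> rw [hk] <;> decide
  obtain ⟨lu, hlu, -, hq0, hqv⟩ := starIdx_facts₂.2.1 lv hlv hk
  exact ⟨hcpSite a h lu, hcpSite_mem_refStar hlu, norm_sq_hcpSite_of_siteQ_eq hq0,
    dist_hcpSite_of_siteQ_eq ha hqv⟩

omit ha₂ hh₁ hh₂ in
/-- **Two distinct polar struts are at distance `a` or at squared distance `≥ 4h²`.** [folklore] -/
theorem polar_dist_cases (hρ : a ^ 2 / 3 + h ^ 2 ≠ a ^ 2) {u w : EuclideanSpace ℝ (Fin 3)}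
    (hu : u ∈ F) (hw : w ∈ F) (huw : u ≠ w) (hnu : ‖u‖ ^ 2 = a ^ 2 / 3 + h ^ 2)
    (hnw : ‖w‖ ^ 2 = a ^ 2 / 3 + h ^ 2) : dist u w = a ∨ 4 * h ^ 2 ≤ dist u w ^ 2 := by
  have ha : 0 ≤ a := by linarith
  rcases norm_cases ha₁ hF hu with h1 | ⟨-, hFh⟩
  · exfalso; rw [h1] at hnu; exact hρ hnu.symm
  subst hFh
  have hpol : ∀ {v : EuclideanSpace ℝ (Fin 3)}, v ∈ (refStar a h : Set (EuclideanSpace ℝ (Fin 3))) →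
      ‖v‖ ^ 2 = a ^ 2 / 3 + h ^ 2 → ∃ lv ∈ hcpStarIdx, lv.1 ≠ 0 ∧ hcpSite a h lv = v := by
    intro v hv hn
    obtain ⟨lv, hlv, rfl⟩ := mem_coe_refStar_iff.1 hv
    refine ⟨lv, hlv, ?_, rfl⟩
    rcases starIdx_facts.1 lv hlv with ⟨-, hq⟩ | ⟨hk, -⟩
    · exfalso
      have := norm_hcpSite_of_siteQ_eq (a := a) (h := h) ha hq
      rw [this] at hn
      exact hρ hn.symm
    · rcases hk with hk | hk <;> rw [hk] <;> decide
  obtain ⟨lu, hlu, hku, rfl⟩ := hpol hu hnu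
  obtain ⟨lw, hlw, hkw, rfl⟩ := hpol hw hnw
  have hne : lu ≠ lw := by rintro rfl; exact huw rfl
  rcases starIdx_facts₂.2.2 lu hlu lw hlw hku hkw hne with hq | hq
  · exact Or.inl (dist_hcpSite_of_siteQ_eq ha (v := lw) (w := lu) hq)
  · right
    rw [hcpSite_dist_sq]
    obtain ⟨hq1, -⟩ := siteQ_nonneg lu lw
    have hq1' : (0 : ℝ) ≤ (siteQ lu lw).1 := by exact_mod_cast hq1
    have hq' : (4 : ℝ) ≤ (siteQ lu lw).2 := by exact_mod_cast hq
    nlinarith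

end Box

end Summit.AtomisticToContinuum.Crystallization.Theorems.PricedHcpWindowsSimilarStarNormalisation

end
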